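import Summits.QuantumFields.QCD.Theses.NestedDissectionSea

/-!
# Sketch — crux-ideate stmt-QuantumFields-13900 (NegativeCellsDilute), ideator k = 1, round 1

First checkable statements ("First lemma" fields) of the crux idea cards, stated over the landed
vocabulary `Literature/MathematicalPhysics/QuantumLattice/WilsonCellSchur.lean` (`wilsonCell`,
`childrenBlock`, `schurSeparator`, `childrenInterior`, `IsSignDefect`) and the route decl
`Summit.QuantumFields.QCD.Theses.NestedDissectionSea.NegativeCellsDilute`. Nothing here is proved;
every item is a `def … : Prop` that must elaborate.
-/

namespace Summit.QuantumFields.QCD.Cruxes.NegativeCellsDilute.Sketch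

open Matrix
open Literature.MathematicalPhysics.QuantumLattice Literature.MathematicalPhysics.QuantumFieldTheory
  Literature.Probability.LatticeModels

/-- Colour group `SU(3)`. -/
local notation "𝔾" => Matrix.specialUnitaryGroup (Fin 3) ℂ

/-- Card `price-the-seed-not-the-spot`, First lemma (DIRAC BALANCE). A kernel vector of the Dirichlet
Wilson cell at bare mass `μ'` balances the Hermitian (Wilson + mass) part against the anti-Hermitian
(naive Dirac) part: `(M + Mᴴ) w = -(M - Mᴴ) w`, and the anti-Hermitian part has vanishing expectation.
With `KineticEdge` (real part) this is the full content of the eigen-equation; after RG dressing it is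
the germ of the carrier trichotomy (topological seed / TI-island wall mode / late dislocation). -/
def DiracBalance : Prop :=
  ∀ (N : ℕ) [NeZero N] (U : GaugeConfig 4 N 𝔾) (μ' : ℝ) (x : TorusSite 4 N) (s : Fin 4 → ℕ)
    (w : {p // wilsonBox x s p} → ℂ),
    (wilsonCell U μ' x s).mulVec w = 0 →
      ((wilsonCell U μ' x s) + (wilsonCell U μ' x s)ᴴ).mulVec w =
          -(((wilsonCell U μ' x s) - (wilsonCell U μ' x s)ᴴ).mulVec w) ∧
        star w ⬝ᵥ ((wilsonCell U μ' x s) - (wilsonCell U μ' x s)ᴴ).mulVec w = 0 ∧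
        ‖(WithLp.equiv 2 _).symm (((wilsonCell U μ' x s) + (wilsonCell U μ' x s)ᴴ).mulVec w)‖ =
          ‖(WithLp.equiv 2 _).symm (((wilsonCell U μ' x s) - (wilsonCell U μ' x s)ᴴ).mulVec w)‖

/-- Card `price-the-seed-not-the-spot`, quantitative kinetic edge (support, provable now):
`d/dμ (D_c(μ)ᴴ D_c(μ)) = 2 (Hermitian part) ≥ 2 (μ + e_X)`, hence for `μ ≥ -e_X` the cell has singular
values `≥ μ + e_X`; stated as: a `τ`-near-kernel vector forces `μ + e_X ≤ τ`. -/
def QuantitativeKineticEdge : Prop :=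
  ∀ (N : ℕ) [NeZero N] (U : GaugeConfig 4 N 𝔾) (μ τ : ℝ) (x : TorusSite 4 N) (s : Fin 4 → ℕ)
    (w : {p // wilsonBox x s p} → ℂ), (∀ i, s i ≤ N) → 0 ≤ τ → w ≠ 0 →
    ‖(WithLp.equiv 2 _).symm ((wilsonCell U μ x s).mulVec w)‖ ≤
        τ * ‖(WithLp.equiv 2 _).symm w‖ →
      μ + ∑ i, (1 - Real.cos (Real.pi / s i)) ≤ τ

/-- Card `sheet-signature-is-rigid`, First lemma (a): the inverse of the Schur separator matrix is the
separator block of the inverse cell matrix — the separator factor is read off the VALENCE PROPAGATOR of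
the cell restricted to the internal sheets (Neumann-to-Dirichlet duality; Mathlib block-inverse). -/
def SchurInvIsPropagatorBlock : Prop :=
  ∀ (N : ℕ) [NeZero N] (U : GaugeConfig 4 N 𝔾) (μ : ℝ) (s : Fin 4 → ℕ),
    IsUnit (wilsonCell U μ 0 s).det → IsUnit (childrenBlock U μ s).det →
      (schurSeparator U μ s)⁻¹ =
        ((wilsonCell U μ 0 s)⁻¹).toBlock (fun p => ¬ childrenInterior s p)
          (fun p => ¬ childrenInterior s p)

/-- Card `sheet-signature-is-rigid`, First lemma (b): negative inertia is invariant under inversion of an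
invertible Hermitian matrix (the eigenvalues of `A⁻¹` are the reciprocals) — so the parity deciding a
level-`j` sign defect can be read off `γ₅ × (cell propagator on the separator)`. -/
def NegInertiaInv : Prop :=
  ∀ (n : Type) [Fintype n] [DecidableEq n] (A : Matrix n n ℂ) (hA : A.IsHermitian)
    (hA' : (A⁻¹).IsHermitian), IsUnit A.det →
      (Finset.univ.filter fun i => hA.eigenvalues i < 0).card =
        (Finset.univ.filter fun i => hA'.eigenvalues i < 0).card

/-- Card `sheet-signature-is-rigid`, rigidity (Weyl): two invertible Hermitian matrices closer in operator
norm than the spectral gap of one of them around `0` have the same negative inertia. -/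
def InertiaRigid : Prop :=
  ∀ (n : Type) [Fintype n] [DecidableEq n] (K K' : Matrix n n ℂ) (hK : K.IsHermitian)
    (hK' : K'.IsHermitian) (g : ℝ), 0 < g → (∀ i, g ≤ |hK.eigenvalues i|) →
      (∀ v : n → ℂ, ‖(WithLp.equiv 2 _).symm ((K' - K).mulVec v)‖ < g * ‖(WithLp.equiv 2 _).symm v‖) →
        (Finset.univ.filter fun i => hK.eigenvalues i < 0).card =
          (Finset.univ.filter fun i => hK'.eigenvalues i < 0).card

/-- Counting device used by both cards (CHIRALITY SPEED): along the Hermitian flow `H(μ) = H₀ + μ Γ`,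
`Γ² = 1`, every eigenvalue branch is `1`-Lipschitz in `μ` (Weyl), so crossings of `0` on `[a, b]` are
bounded by the `μ`-integral of the zero-energy density of states. Lipschitz form: -/
def ChiralitySpeed : Prop :=
  ∀ (n : Type) [Fintype n] [DecidableEq n] (H₀ Γ : Matrix n n ℂ) (h₀ : H₀.IsHermitian)
    (hΓ : Γ.IsHermitian), Γ * Γ = 1 → ∀ (μ μ' : ℝ)
      (h : (H₀ + (μ : ℂ) • Γ).IsHermitian) (h' : (H₀ + (μ' : ℂ) • Γ).IsHermitian) (i : n),
        |h.eigenvalues i - h'.eigenvalues i| ≤ |μ - μ'|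

/-- The crux, by name (sanity: the cards conclude `NegativeCellsDilute`, never a restatement). -/
example : Prop := Summit.QuantumFields.QCD.Theses.NestedDissectionSea.NegativeCellsDilute

end Summit.QuantumFields.QCD.Cruxes.NegativeCellsDilute.Sketch
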